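import Summits.CriticalPhenomena.SAWScalingLimit.Theorems.SAWDefectDecoherenceBoundaryClosureRGateMassLaws
import HarnessLib

/-!
# Crux `BoundaryClosureR` (stmt-CriticalPhenomena-14004), line `pick-half-plane`:
gate comparability (a) of `stub_gateMassLaws` follows from POINTWISE comparability on the gate

Landing target:
`Summits/CriticalPhenomena/SAWScalingLimit/Theorems/SAWDefectDecoherenceBoundaryClosureRGateMassLawsReduction.lean`
(`--supports stmt-CriticalPhenomena-14004`).

`GateMassLaws` (a) compares the arrival mass `Z_δ(b_δ)` at the normaliser with the AVERAGE
`δ Σ_{e' ∈ ∂Λ_δ, δ·mid e' ∈ ball y ρ'} Z_δ(e')` over a sub-ball of the gate.  The natural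
(boundary-Harnack) form of the conjecture is POINTWISE: every floor mid-edge of the gate row whose
scaled midpoint lies in the sub-ball carries an arrival mass in `[C⁻¹ Z_δ(b_δ), C Z_δ(b_δ)]`.  Here:

* `§6` counting: the columns `k` with `|δ(k + s) - u| ≤ w` (resp. `< w`) form (resp. lie in) an
  integer interval with between `2w/δ - 1` and `2w/δ + 1` elements;
* `§7` **`gateComparability_of_pointwise`**: pointwise comparability implies the averaged two-sided
  bound of (a), verbatim, with `C' = max (3ρ'C) (2C/ρ')` — for ARBITRARY nonnegative weights, so
  this is pure lattice bookkeeping on top of the window identification and the convergence of the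
  floor height of the sibling file `…GateMassLaws.lean`.

What remains OPEN of the stub after this reduction: the pointwise comparability itself and the
root-arm divergence (b).  Sources: H. Duminil-Copin, S. Smirnov, Ann. of Math. 175 (2012), §3.
-/

noncomputable section

open scoped BigOperators Topology
open Filter Set
open Literature.Probability.LatticeModels (HexVertex hexGraph hexCenter Site)
open Literature.Probability.RandomPlanarGeometry
open Literature.Probability.RandomPlanarGeometry.SAW

namespace Summit.CriticalPhenomena.SAWScalingLimit.Theorems.PickHalfPlane.GateMass

/-! ### 6. Counting the columns of a window -/

/-- The columns `k` of the closed real window `|δ (k + s) - u| ≤ w` contain the integer interval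
`[⌈(u - w)/δ - s⌉, ⌊(u + w)/δ - s⌋]`. [folklore] -/
theorem abs_le_of_mem_Icc {δ s u w : ℝ} (hδ : 0 < δ) {k : ℤ}
    (hk : k ∈ Finset.Icc ⌈(u - w) / δ - s⌉ ⌊(u + w) / δ - s⌋) : |δ * (k + s) - u| ≤ w := by
  rw [Finset.mem_Icc, Int.ceil_le, Int.le_floor] at hk
  obtain ⟨h1, h2⟩ := hk
  rw [sub_le_iff_le_add, div_le_iff₀ hδ] at h1
  rw [le_sub_iff_add_le, le_div_iff₀ hδ] at h2
  rw [abs_le]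
  constructor <;> nlinarith

/-- … and that integer interval has at least `2w/δ - 1` elements. [folklore] -/
theorem le_card_Icc (δ s u w : ℝ) :
    2 * w / δ - 1 ≤ ((Finset.Icc ⌈(u - w) / δ - s⌉ ⌊(u + w) / δ - s⌋).card : ℝ) := by
  rw [Int.card_Icc]
  have h1 : ((⌊(u + w) / δ - s⌋ + 1 - ⌈(u - w) / δ - s⌉ : ℤ) : ℝ) ≤
      (((⌊(u + w) / δ - s⌋ + 1 - ⌈(u - w) / δ - s⌉).toNat : ℕ) : ℝ) := by
    exact_mod_cast Int.self_le_toNat _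
  have h2 := Int.sub_one_lt_floor ((u + w) / δ - s)
  have h3 := Int.ceil_lt_add_one ((u - w) / δ - s)
  push_cast at h1
  have h4 : 2 * w / δ = (u + w) / δ - (u - w) / δ := by
    rw [← sub_div]; ring_nf
  linarith

/-- The columns `k` of the open real window `|δ (k + s) - u| < w` lie in the integer interval
`[⌈(u - w)/δ - s⌉, ⌊(u + w)/δ - s⌋]`. [folklore] -/
theorem mem_Icc_of_abs_lt {δ s u w : ℝ} (hδ : 0 < δ) {k : ℤ} (hk : |δ * (k + s) - u| < w) :
    k ∈ Finset.Icc ⌈(u - w) / δ - s⌉ ⌊(u + w) / δ - s⌋ := by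
  rw [abs_lt] at hk
  obtain ⟨h1, h2⟩ := hk
  rw [Finset.mem_Icc, Int.ceil_le, Int.le_floor, sub_le_iff_le_add, div_le_iff₀ hδ,
    le_sub_iff_add_le, le_div_iff₀ hδ]
  constructor <;> nlinarith

/-- … and that integer interval has at most `2w/δ + 1` elements (`w ≥ 0`). [folklore] -/
theorem card_Icc_le {δ s u w : ℝ} (hδ : 0 < δ) (hw : 0 ≤ w) :
    ((Finset.Icc ⌈(u - w) / δ - s⌉ ⌊(u + w) / δ - s⌋).card : ℝ) ≤ 2 * w / δ + 1 := by
  rw [Int.card_Icc]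
  have h0 : (0 : ℝ) ≤ 2 * w / δ + 1 := by positivity
  have h1 : (((⌊(u + w) / δ - s⌋ + 1 - ⌈(u - w) / δ - s⌉).toNat : ℕ) : ℝ) =
      max ((⌊(u + w) / δ - s⌋ + 1 - ⌈(u - w) / δ - s⌉ : ℤ) : ℝ) 0 := by
    have := Int.toNat_eq_max (⌊(u + w) / δ - s⌋ + 1 - ⌈(u - w) / δ - s⌉)
    exact_mod_cast this
  rw [h1, max_le_iff]
  refine ⟨?_, h0⟩
  have h2 := Int.floor_le ((u + w) / δ - s)
  have h3 := Int.le_ceil ((u - w) / δ - s)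
  have h4 : 2 * w / δ = (u + w) / δ - (u - w) / δ := by
    rw [← sub_div]; ring_nf
  push_cast
  linarith

/-! ### 7. Reduction of gate comparability (a) to POINTWISE comparability on the gate

`GateMassLaws` (a) compares `Z_δ(b_δ)` with the AVERAGE `δ Σ_{e' ∈ ∂Λ_δ, δ·mid e' ∈ ball y ρ'} Z_δ(e')`
over a gate sub-ball.  The natural (boundary-Harnack) form of the conjecture is POINTWISE: every
floor mid-edge of the gate row whose scaled midpoint lies in the sub-ball carries an arrival mass
comparable to `Z_δ(b_δ)`.  The theorems below show that the pointwise form implies the averaged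
form (a) — for ARBITRARY nonnegative weights `Z`, so this is pure lattice bookkeeping: the window is
an integer interval of `≍ ρ'/δ` columns (`§4`–`§6`) once the floor row has come within `ρ'/2` of
the gate line (`tendsto_floorHeight`). -/

/-- **Pointwise ⟹ averaged, at one mesh.**  At a mesh `0 < δ < ρ'/2`: if the lattice pin holds at
`c` (radius `ρ`), the sub-ball `ball y ρ'` is `δ/2`-deep in the pinned ball, the floor line of the
threshold row `m` is within `ρ'/2` of the height of `y`, and every floor mid-edge of the row `m`
with scaled midpoint in `ball y ρ'` has weight in `[C⁻¹ Z_b, C Z_b]` (`Z ≥ 0`, `Z_b ≥ 0`), then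
`C'⁻¹ Z_b ≤ δ Σ_{e' ∈ ∂Λ, δ·mid e' ∈ ball y ρ'} Z(e') ≤ C' Z_b` with `C' = max (3ρ'C) (2C/ρ')`
(the window has between `ρ'/(2δ)` and `3ρ'/δ` columns).
[cite: DuminilCopinSmirnov2012, §3 (the boundary part α of the strip)] -/
theorem gateComparability_of_pointwise_at {Λ : Finset HexVertex} {m : ℤ} {δ ρ ρ' C Zb : ℝ}
    {c y : ℂ} {Z : Sym2 HexVertex → ℝ} (hδ : 0 < δ) (hδρ' : δ < ρ' / 2) (hρ' : 0 < ρ') (hC : 0 < C)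
    (hpin : ∀ v : HexVertex, (δ : ℂ) * hexCenter v ∈ Metric.ball c ρ → (v ∈ Λ ↔ m ≤ v.1 1))
    (hS : ∀ z ∈ Metric.ball y ρ', dist z c + δ / 2 < ρ)
    (hheight : |δ * (m : ℝ) * (Real.sqrt 3 / 2) - y.im| < ρ' / 2)
    (hZ : ∀ e, 0 ≤ Z e) (hZb : 0 ≤ Zb)
    (hpt : ∀ k : ℤ,
      (δ : ℂ) * hexMidpoint s((((![k, m - 1] : Site 2)), (1 : Fin 2)), ((![k, m] : Site 2), (0 : Fin 2)))
          ∈ Metric.ball y ρ' →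
        C⁻¹ * Zb ≤ Z s((((![k, m - 1] : Site 2)), (1 : Fin 2)), ((![k, m] : Site 2), (0 : Fin 2))) ∧
        Z s((((![k, m - 1] : Site 2)), (1 : Fin 2)), ((![k, m] : Site 2), (0 : Fin 2))) ≤ C * Zb) :
    (max (3 * ρ' * C) (2 * C / ρ'))⁻¹ * Zb ≤ δ * ∑ᶠ e' ∈ {e' : Sym2 HexVertex |
        e' ∈ hexDomainBoundary Λ ∧ (δ : ℂ) * hexMidpoint e' ∈ Metric.ball y ρ'}, Z e' ∧
      δ * ∑ᶠ e' ∈ {e' : Sym2 HexVertex |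
        e' ∈ hexDomainBoundary Λ ∧ (δ : ℂ) * hexMidpoint e' ∈ Metric.ball y ρ'}, Z e' ≤
        max (3 * ρ' * C) (2 * C / ρ') * Zb := by
  -- abbreviations
  set fe : ℤ → Sym2 HexVertex := fun k =>
    s((((![k, m - 1] : Site 2)), (1 : Fin 2)), ((![k, m] : Site 2), (0 : Fin 2))) with hfe
  set K : Set ℤ := {k : ℤ | (δ : ℂ) * hexMidpoint (fe k) ∈ Metric.ball y ρ'} with hK
  have hWδ := boundaryWindow_eq_image (S := Metric.ball y ρ') hδ.le hpin hS
  -- the window sum as a sum over the (finite) integer window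
  have hsum : ∑ᶠ e' ∈ {e' : Sym2 HexVertex | e' ∈ hexDomainBoundary Λ ∧
      (δ : ℂ) * hexMidpoint e' ∈ Metric.ball y ρ'}, Z e' = ∑ᶠ k ∈ K, Z (fe k) := by
    rw [hWδ, finsum_mem_image (floorEdge_injective m).injOn]
  have hKfin : K.Finite := finite_intWindow (S := Metric.ball y ρ') hδ.le hpin hS
  rw [hsum, finsum_mem_eq_finite_toFinset_sum _ hKfin]
  -- real and imaginary parts of the scaled floor midpoints
  set sδ : ℝ := (m : ℝ) / 2 + 1 / 2 with hsδ
  have hre : ∀ k : ℤ, ((δ : ℂ) * hexMidpoint (fe k)).re = δ * (k + sδ) := by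
    intro k
    rw [Complex.mul_re, Complex.ofReal_re, Complex.ofReal_im, zero_mul, sub_zero, hfe,
      re_hexMidpoint_floorEdge', hsδ]
    ring
  have him : ∀ k : ℤ, ((δ : ℂ) * hexMidpoint (fe k)).im = δ * (m : ℝ) * (Real.sqrt 3 / 2) := by
    intro k
    rw [Complex.mul_im, Complex.ofReal_re, Complex.ofReal_im, zero_mul, add_zero, hfe,
      im_hexMidpoint_floorEdge']
    ring
  -- inner and outer integer intervals
  set I₁ : Finset ℤ := Finset.Icc ⌈(y.re - ρ' / 2) / δ - sδ⌉ ⌊(y.re + ρ' / 2) / δ - sδ⌋ with hI₁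
  set I₂ : Finset ℤ := Finset.Icc ⌈(y.re - ρ') / δ - sδ⌉ ⌊(y.re + ρ') / δ - sδ⌋ with hI₂
  have hI₁K : I₁ ⊆ hKfin.toFinset := by
    intro k hk
    rw [Set.Finite.mem_toFinset, hK, Set.mem_setOf_eq, Metric.mem_ball, Complex.dist_eq,
      Complex.norm_def, Complex.normSq_apply, Complex.sub_re, Complex.sub_im, hre, him]
    have h1 : |δ * (k + sδ) - y.re| ≤ ρ' / 2 := abs_le_of_mem_Icc hδ hk
    have h2 : (δ * (↑k + sδ) - y.re) * (δ * (↑k + sδ) - y.re) +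
        (δ * (m : ℝ) * (Real.sqrt 3 / 2) - y.im) * (δ * (m : ℝ) * (Real.sqrt 3 / 2) - y.im) <
          ρ' * ρ' := by
      rw [abs_le] at h1
      rw [abs_lt] at hheight
      nlinarith
    calc Real.sqrt ((δ * (↑k + sδ) - y.re) * (δ * (↑k + sδ) - y.re) +
          (δ * (m : ℝ) * (Real.sqrt 3 / 2) - y.im) * (δ * (m : ℝ) * (Real.sqrt 3 / 2) - y.im))
        < Real.sqrt (ρ' * ρ') :=
          Real.sqrt_lt_sqrt (add_nonneg (mul_self_nonneg _) (mul_self_nonneg _)) h2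
      _ = ρ' := Real.sqrt_mul_self hρ'.le
  have hKI₂ : hKfin.toFinset ⊆ I₂ := by
    intro k hk
    rw [Set.Finite.mem_toFinset, hK, Set.mem_setOf_eq, Metric.mem_ball] at hk
    refine mem_Icc_of_abs_lt hδ (lt_of_le_of_lt ?_ hk)
    rw [← hre, ← Complex.sub_re, Complex.dist_eq]
    exact Complex.abs_re_le_norm _
  -- pointwise bounds on the window
  have hlow : ∀ k ∈ hKfin.toFinset, C⁻¹ * Zb ≤ Z (fe k) := fun k hk =>
    (hpt k (hKfin.mem_toFinset.1 hk)).1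
  have hup : ∀ k ∈ hKfin.toFinset, Z (fe k) ≤ C * Zb := fun k hk =>
    (hpt k (hKfin.mem_toFinset.1 hk)).2
  have hcard₁ : 2 * (ρ' / 2) / δ - 1 ≤ (I₁.card : ℝ) := le_card_Icc δ sδ y.re (ρ' / 2)
  have hcard₂ : (I₂.card : ℝ) ≤ 2 * ρ' / δ + 1 := card_Icc_le hδ hρ'.le
  constructor
  · -- lower bound: at least `ρ'/(2δ)` columns, each of weight `≥ C⁻¹ Z_b`
    have h1 : (I₁.card : ℝ) * (C⁻¹ * Zb) ≤ ∑ k ∈ hKfin.toFinset, Z (fe k) := by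
      calc (I₁.card : ℝ) * (C⁻¹ * Zb) = ∑ k ∈ I₁, C⁻¹ * Zb := by
            rw [Finset.sum_const, nsmul_eq_mul]
        _ ≤ ∑ k ∈ I₁, Z (fe k) := Finset.sum_le_sum fun k hk => hlow k (hI₁K hk)
        _ ≤ ∑ k ∈ hKfin.toFinset, Z (fe k) :=
            Finset.sum_le_sum_of_subset_of_nonneg hI₁K fun _ _ _ => hZ _
    have h2 : ρ' / (2 * δ) ≤ (I₁.card : ℝ) := by
      have e1 : 2 * (ρ' / 2) / δ - 1 = ρ' / δ - 1 := by ring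
      have e2 : ρ' / (2 * δ) = ρ' / δ / 2 := by rw [div_div, mul_comm]
      have h3 : 2 ≤ ρ' / δ := by rw [le_div_iff₀ hδ]; linarith
      rw [e1] at hcard₁
      rw [e2]
      linarith
    have h3 : (max (3 * ρ' * C) (2 * C / ρ'))⁻¹ * Zb ≤ ρ' / (2 * C) * Zb := by
      refine mul_le_mul_of_nonneg_right ?_ hZb
      rw [show ρ' / (2 * C) = (2 * C / ρ')⁻¹ by rw [inv_div]]
      exact inv_anti₀ (by positivity) (le_max_right _ _)
    refine h3.trans ?_
    calc ρ' / (2 * C) * Zb = δ * (ρ' / (2 * δ) * (C⁻¹ * Zb)) := by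
          field_simp
      _ ≤ δ * ((I₁.card : ℝ) * (C⁻¹ * Zb)) := by
          refine mul_le_mul_of_nonneg_left ?_ hδ.le
          exact mul_le_mul_of_nonneg_right h2 (by positivity)
      _ ≤ δ * ∑ k ∈ hKfin.toFinset, Z (fe k) := mul_le_mul_of_nonneg_left h1 hδ.le
  · -- upper bound: at most `3ρ'/δ` columns, each of weight `≤ C Z_b`
    have h1 : ∑ k ∈ hKfin.toFinset, Z (fe k) ≤ (I₂.card : ℝ) * (C * Zb) := by
      calc ∑ k ∈ hKfin.toFinset, Z (fe k) ≤ ∑ k ∈ hKfin.toFinset, C * Zb :=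
            Finset.sum_le_sum hup
        _ = (hKfin.toFinset.card : ℝ) * (C * Zb) := by rw [Finset.sum_const, nsmul_eq_mul]
        _ ≤ (I₂.card : ℝ) * (C * Zb) := by
            refine mul_le_mul_of_nonneg_right ?_ (by positivity)
            exact_mod_cast Finset.card_le_card hKI₂
    have h2 : δ * (I₂.card : ℝ) ≤ 3 * ρ' := by
      have : δ * (I₂.card : ℝ) ≤ δ * (2 * ρ' / δ + 1) := mul_le_mul_of_nonneg_left hcard₂ hδ.le
      rw [mul_add, mul_div_cancel₀ _ hδ.ne', mul_one] at this
      linarith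
    calc δ * ∑ k ∈ hKfin.toFinset, Z (fe k) ≤ δ * ((I₂.card : ℝ) * (C * Zb)) :=
          mul_le_mul_of_nonneg_left h1 hδ.le
      _ = (δ * (I₂.card : ℝ)) * C * Zb := by ring
      _ ≤ (3 * ρ') * C * Zb :=
          mul_le_mul_of_nonneg_right (mul_le_mul_of_nonneg_right h2 hC.le) hZb
      _ ≤ max (3 * ρ' * C) (2 * C / ρ') * Zb := mul_le_mul_of_nonneg_right (le_max_left _ _) hZb

/-- **Pointwise gate comparability implies gate comparability (a).**  Let the lattice pin hold at
`c` (radius `ρ > 0`) eventually, let the normaliser `b δ ∈ ∂(Λ δ)` have `δ·mid(b δ) → c`, let `y`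
be a point of the horizontal line through `c` with `closedBall y ρ' ⊆ ball c ρ`, `ρ' > 0`, and let
`Z δ ≥ 0` be any weights.  If for some `C > 0`, eventually, every floor mid-edge `floorEdge k (m δ)`
with scaled midpoint in `ball y ρ'` has weight in `[C⁻¹ Z δ (b δ), C Z δ (b δ)]`, then for some
`C' > 0`, eventually, `C'⁻¹ Z δ (b δ) ≤ δ Σ_{e' ∈ ∂(Λ δ), δ·mid e' ∈ ball y ρ'} Z δ e' ≤ C' Z δ (b δ)`
— verbatim the conclusion of `GateMassLaws` (a) for the weights `Z δ e' = ‖F_{Λ δ, e δ, x_c, 0}(e')‖`.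
[cite: DuminilCopinSmirnov2012, §3 (the boundary part α of the strip)] -/
theorem gateComparability_of_pointwise {Λ : ℝ → Finset HexVertex} {m : ℝ → ℤ} {ρ ρ' : ℝ}
    {c y : ℂ} {b : ℝ → Sym2 HexVertex} {Z : ℝ → Sym2 HexVertex → ℝ} (hρ : 0 < ρ)
    (hpin : ∀ᶠ δ : ℝ in 𝓝[>] 0, ∀ v : HexVertex,
      (δ : ℂ) * hexCenter v ∈ Metric.ball c ρ → (v ∈ Λ δ ↔ m δ ≤ v.1 1))
    (hb : ∀ᶠ δ : ℝ in 𝓝[>] 0, b δ ∈ hexDomainBoundary (Λ δ))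
    (hlim : Tendsto (fun δ : ℝ => (δ : ℂ) * hexMidpoint (b δ)) (𝓝[>] 0) (𝓝 c))
    (hZ : ∀ δ e, 0 ≤ Z δ e) (hy : y.im = c.im) (hρ' : 0 < ρ')
    (hball : Metric.closedBall y ρ' ⊆ Metric.ball c ρ)
    (hpt : ∃ C : ℝ, 0 < C ∧ ∀ᶠ δ : ℝ in 𝓝[>] 0, ∀ k : ℤ,
      (δ : ℂ) * hexMidpoint s((((![k, m δ - 1] : Site 2)), (1 : Fin 2)), ((![k, m δ] : Site 2), (0 : Fin 2)))
          ∈ Metric.ball y ρ' →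
        C⁻¹ * Z δ (b δ) ≤ Z δ s((((![k, m δ - 1] : Site 2)), (1 : Fin 2)), ((![k, m δ] : Site 2), (0 : Fin 2))) ∧
        Z δ s((((![k, m δ - 1] : Site 2)), (1 : Fin 2)), ((![k, m δ] : Site 2), (0 : Fin 2))) ≤ C * Z δ (b δ)) :
    ∃ C : ℝ, 0 < C ∧ ∀ᶠ δ : ℝ in 𝓝[>] 0,
      C⁻¹ * Z δ (b δ) ≤ δ * ∑ᶠ e' ∈ {e' : Sym2 HexVertex | e' ∈ hexDomainBoundary (Λ δ) ∧
          (δ : ℂ) * hexMidpoint e' ∈ Metric.ball y ρ'}, Z δ e' ∧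
      δ * ∑ᶠ e' ∈ {e' : Sym2 HexVertex | e' ∈ hexDomainBoundary (Λ δ) ∧
          (δ : ℂ) * hexMidpoint e' ∈ Metric.ball y ρ'}, Z δ e' ≤ C * Z δ (b δ) := by
  obtain ⟨C, hC, hptC⟩ := hpt
  refine ⟨max (3 * ρ' * C) (2 * C / ρ'), lt_max_of_lt_left (by positivity), ?_⟩
  -- the floor height is eventually within `ρ'/2` of the gate line
  have hheight : ∀ᶠ δ : ℝ in 𝓝[>] 0, |δ * (m δ : ℝ) * (Real.sqrt 3 / 2) - y.im| < ρ' / 2 := by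
    have h' : ∀ᶠ δ : ℝ in 𝓝[>] 0, dist (δ * (m δ : ℝ) * (Real.sqrt 3 / 2)) c.im < ρ' / 2 :=
      tendsto_floorHeight hρ hpin hb hlim (Metric.ball_mem_nhds _ (half_pos hρ'))
    filter_upwards [h'] with δ hδ
    rwa [Real.dist_eq, ← hy] at hδ
  -- the sub-ball is eventually `δ/2`-deep in the pinned ball, and `δ < ρ'/2`
  obtain ⟨ρ₁, hρ₁, hsub⟩ := exists_lt_subset_ball Metric.isClosed_closedBall hball
  have hsmall : ∀ᶠ δ : ℝ in 𝓝[>] 0, 0 < δ ∧ δ < min (ρ' / 2) (ρ - ρ₁) := by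
    have h1 : ∀ᶠ δ : ℝ in 𝓝[>] 0, δ ∈ Set.Ioo 0 (min (ρ' / 2) (ρ - ρ₁)) :=
      Ioo_mem_nhdsGT (lt_min (half_pos hρ') (by linarith))
    exact h1
  filter_upwards [hpin, hptC, hheight, hsmall] with δ hpinδ hptδ hhδ hδ
  have hδ1 : δ < ρ' / 2 := lt_of_lt_of_le hδ.2 (min_le_left _ _)
  have hδ2 : δ < ρ - ρ₁ := lt_of_lt_of_le hδ.2 (min_le_right _ _)
  refine gateComparability_of_pointwise_at hδ.1 hδ1 hρ' hC hpinδ (fun z hz => ?_) hhδ (hZ δ)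
    (hZ δ _) hptδ
  have : dist z c < ρ₁ := hsub (Metric.ball_subset_closedBall hz)
  linarith

/-- **Registered sub-goal `stub_gateMassLaws_comparabilityReduction`** (crux item
stmt-CriticalPhenomena-14004, line `pick-half-plane`, stub `stub_gateMassLaws`): pointwise gate
comparability implies the averaged two-sided gate bound of `GateMassLaws` (a), for arbitrary
nonnegative weights (`gateComparability_of_pointwise`).
[cite: DuminilCopinSmirnov2012, §3 (the boundary part α of the strip)] -/
theorem stub_gateMassLaws_comparabilityReduction : ∀ (Λ : ℝ → Finset HexVertex) (m : ℝ → ℤ) (ρ ρ' : ℝ) (c y : ℂ) (b : ℝ → Sym2 HexVertex) (Z : ℝ → Sym2 HexVertex → ℝ), 0 < ρ → (∀ᶠ δ : ℝ in 𝓝[>] 0, ∀ v : HexVertex, (δ : ℂ) * hexCenter v ∈ Metric.ball c ρ → (v ∈ Λ δ ↔ m δ ≤ v.1 1)) → (∀ᶠ δ : ℝ in 𝓝[>] 0, b δ ∈ hexDomainBoundary (Λ δ)) → Tendsto (fun δ : ℝ => (δ : ℂ) * hexMidpoint (b δ)) (𝓝[>] 0) (𝓝 c) → (∀ δ e, 0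 ≤ Z δ e) → y.im = c.im → 0 < ρ' → Metric.closedBall y ρ' ⊆ Metric.ball c ρ → (∃ C : ℝ, 0 < C ∧ ∀ᶠ δ : ℝ in 𝓝[>] 0, ∀ k : ℤ, (δ : ℂ) * hexMidpoint s((((![k, m δ - 1] : Site 2)), (1 : Fin 2)), ((![k, m δ] : Site 2), (0 : Fin 2))) ∈ Metric.ball y ρ' → C⁻¹ * Z δ (b δ) ≤ Z δ s((((![k, m δ - 1] : Site 2)), (1 : Fin 2)), ((![k, m δ] : Site 2), (0 : Fin 2))) ∧ Z δ s((((![k, m δ - 1] : Site 2)), (1 : Fin 2)), ((![k, m δ] : Site 2), (0 : Fin 2))) ≤ C * Z δ (b δ)) → ∃ C : ℝ, 0 < C ∧ ∀ᶠ δ : ℝ in 𝓝[>] 0, C⁻¹ * Z δ (b δ) ≤ δ * ∑ᶠ e' ∈ {e' : Sym2 HexVertex | e' ∈ hexDomainBoundary (Λ δ) ∧ (δ : ℂ) * hexMidpoint e' ∈ Metric.ball y ρ'}, Z δ e' ∧ δ * ∑ᶠ e' ∈ {e' : Sym2 HexVertex | e' ∈ hexDomainBoundary (Λ δ) ∧ (δ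 : ℂ) * hexMidpoint e' ∈ Metric.ball y ρ'}, Z δ e' ≤ C * Z δ (b δ) :=
  fun _ _ _ _ _ _ _ _ hρ hpin hb hlim hZ hy hρ' hball hpt =>
    gateComparability_of_pointwise hρ hpin hb hlim hZ hy hρ' hball hpt

/-! ### 8. Glue for a reshape of the stub: `GateMassLaws` from the pointwise law and (b)

The registered stub `stub_gateMassLaws : GateMassLaws` (conjuncts (a) ∧ (b) under the binders of an
admissible family and a pinned flat root) follows from the POINTWISE gate comparability (a*) and the
root-arm divergence (b), stated under the same binders — with `AdmissibleFamily`, `PinnedFlatRoot`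
and the `let Z` of the skeleton written out, so that in the skeleton
`exact gateMassLaws_of_pointwise_of_arm hA hB` closes the stub from two registered sub-stubs. -/

/-- **`GateMassLaws` from (a*) pointwise gate comparability and (b) root-arm divergence** (the
conclusion is verbatim the body of `…Cruxes.BoundaryClosureR.PickHalfPlane.GateMassLaws`, the two antecedents are (a*) and (b) under
the same binders with `AdmissibleFamily` / `PinnedFlatRoot` written out).
[cite: DuminilCopinSmirnov2012, §3 (the boundary part α of the strip)] -/
theorem gateMassLaws_of_pointwise_of_arm :
    (∀ (D : DobrushinDomain) (ρ : ℝ) (Λ : ℝ → Finset HexVertex) (m : ℝ → ℤ)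
      (b : ℝ → Sym2 HexVertex),
      (0 < ρ ∧
      D.carrier ∩ Metric.ball (D.pt 1) ρ = {z : ℂ | (D.pt 1).im < z.im} ∩ Metric.ball (D.pt 1) ρ ∧
      (∀ᶠ δ : ℝ in 𝓝[>] 0, hexDomainSimplyConnected (Λ δ) ∧ b δ ∈ hexDomainBoundary (Λ δ) ∧
          (hexGraph.induce ((Λ δ : Finset HexVertex) : Set HexVertex)).Preconnected ∧
          (∀ v ∈ Λ δ, (δ : ℂ) * hexCenter v ∈ D.carrier) ∧
          (∀ v : HexVertex, (δ : ℂ) * hexCenter v ∈ Metric.ball (D.pt 1) ρ → (v ∈ Λ δ ↔ m δ ≤ v.1 1))) ∧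
      (∀ K : Set ℂ, IsCompact K → K ⊆ D.carrier →
          ∀ᶠ δ : ℝ in 𝓝[>] 0, ∀ v : HexVertex, (δ : ℂ) * hexCenter v ∈ K → v ∈ Λ δ) ∧
      Tendsto (fun δ : ℝ => (δ : ℂ) * hexMidpoint (b δ)) (𝓝[>] 0) (𝓝 (D.pt 1))) →
      ∀ (x : ℂ) (e : ℝ → Sym2 HexVertex) (r : ℝ) (mr : ℝ → ℤ),
      (0 < r ∧
      D.carrier ∩ Metric.ball x r = {z : ℂ | x.im < z.im} ∩ Metric.ball x r ∧
      (∀ᶠ δ : ℝ in 𝓝[>] 0, e δ ∈ hexDomainBoundary (Λ δ) ∧ Nonempty (HexMidEdgeSAW (Λ δ) (e δ) (b δ)) ∧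
          (∀ v : HexVertex, (δ : ℂ) * hexCenter v ∈ Metric.ball x r → (v ∈ Λ δ ↔ mr δ ≤ v.1 1))) ∧
      Tendsto (fun δ : ℝ => (δ : ℂ) * hexMidpoint (e δ)) (𝓝[>] 0) (𝓝 x)) → x ≠ D.pt 1 →
      ∀ (y : ℂ) (ρ' : ℝ), y.im = (D.pt 1).im → 0 < ρ' →
        Metric.closedBall y ρ' ⊆ Metric.ball (D.pt 1) ρ → x ∉ Metric.closedBall y (2 * ρ') →
      ∃ C : ℝ, 0 < C ∧ ∀ᶠ δ : ℝ in 𝓝[>] 0, ∀ k : ℤ,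
        (δ : ℂ) * hexMidpoint s((((![k, m δ - 1] : Site 2)), (1 : Fin 2)), ((![k, m δ] : Site 2), (0 : Fin 2))) ∈ Metric.ball y ρ' →
        C⁻¹ * ‖hexParafermionicObservable (Λ δ) (e δ) hexCriticalFugacity 0 (b δ)‖ ≤
            ‖hexParafermionicObservable (Λ δ) (e δ) hexCriticalFugacity 0 s((((![k, m δ - 1] : Site 2)), (1 : Fin 2)), ((![k, m δ] : Site 2), (0 : Fin 2)))‖ ∧
          ‖hexParafermionicObservable (Λ δ) (e δ) hexCriticalFugacity 0 s((((![k, m δ - 1] : Site 2)), (1 : Fin 2)), ((![k, m δ] : Site 2), (0 : Fin 2)))‖ ≤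
            C * ‖hexParafermionicObservable (Λ δ) (e δ) hexCriticalFugacity 0 (b δ)‖) →
    (∀ (D : DobrushinDomain) (ρ : ℝ) (Λ : ℝ → Finset HexVertex) (m : ℝ → ℤ)
      (b : ℝ → Sym2 HexVertex),
      (0 < ρ ∧
      D.carrier ∩ Metric.ball (D.pt 1) ρ = {z : ℂ | (D.pt 1).im < z.im} ∩ Metric.ball (D.pt 1) ρ ∧
      (∀ᶠ δ : ℝ in 𝓝[>] 0, hexDomainSimplyConnected (Λ δ) ∧ b δ ∈ hexDomainBoundary (Λ δ) ∧
          (hexGraph.induce ((Λ δ : Finset HexVertex) : Set HexVertex)).Preconnected ∧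
          (∀ v ∈ Λ δ, (δ : ℂ) * hexCenter v ∈ D.carrier) ∧
          (∀ v : HexVertex, (δ : ℂ) * hexCenter v ∈ Metric.ball (D.pt 1) ρ → (v ∈ Λ δ ↔ m δ ≤ v.1 1))) ∧
      (∀ K : Set ℂ, IsCompact K → K ⊆ D.carrier →
          ∀ᶠ δ : ℝ in 𝓝[>] 0, ∀ v : HexVertex, (δ : ℂ) * hexCenter v ∈ K → v ∈ Λ δ) ∧
      Tendsto (fun δ : ℝ => (δ : ℂ) * hexMidpoint (b δ)) (𝓝[>] 0) (𝓝 (D.pt 1))) →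
      ∀ (x : ℂ) (e : ℝ → Sym2 HexVertex) (r : ℝ) (mr : ℝ → ℤ),
      (0 < r ∧
      D.carrier ∩ Metric.ball x r = {z : ℂ | x.im < z.im} ∩ Metric.ball x r ∧
      (∀ᶠ δ : ℝ in 𝓝[>] 0, e δ ∈ hexDomainBoundary (Λ δ) ∧ Nonempty (HexMidEdgeSAW (Λ δ) (e δ) (b δ)) ∧
          (∀ v : HexVertex, (δ : ℂ) * hexCenter v ∈ Metric.ball x r → (v ∈ Λ δ ↔ mr δ ≤ v.1 1))) ∧
      Tendsto (fun δ : ℝ => (δ : ℂ) * hexMidpoint (e δ)) (𝓝[>] 0) (𝓝 x)) → x ≠ D.pt 1 →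
      ∀ A : ℝ, ∃ η : ℝ, 0 < η ∧ η < r / 2 ∧ ∀ᶠ δ : ℝ in 𝓝[>] 0,
        A * ‖hexParafermionicObservable (Λ δ) (e δ) hexCriticalFugacity 0 (b δ)‖ ≤
          δ * ∑ᶠ e' ∈ {e' : Sym2 HexVertex | e' ∈ hexDomainBoundary (Λ δ) ∧
            (δ : ℂ) * hexMidpoint e' ∈ Metric.ball x (r / 2) ∧
            x.re + η < ((δ : ℂ) * hexMidpoint e').re},
            ‖hexParafermionicObservable (Λ δ) (e δ) hexCriticalFugacity 0 e'‖) →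
    ∀ (D : DobrushinDomain) (ρ : ℝ) (Λ : ℝ → Finset HexVertex) (m : ℝ → ℤ) (b : ℝ → Sym2 HexVertex),
      (0 < ρ ∧
      D.carrier ∩ Metric.ball (D.pt 1) ρ = {z : ℂ | (D.pt 1).im < z.im} ∩ Metric.ball (D.pt 1) ρ ∧
      (∀ᶠ δ : ℝ in 𝓝[>] 0, hexDomainSimplyConnected (Λ δ) ∧ b δ ∈ hexDomainBoundary (Λ δ) ∧
          (hexGraph.induce ((Λ δ : Finset HexVertex) : Set HexVertex)).Preconnected ∧
          (∀ v ∈ Λ δ, (δ : ℂ) * hexCenter v ∈ D.carrier) ∧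
          (∀ v : HexVertex, (δ : ℂ) * hexCenter v ∈ Metric.ball (D.pt 1) ρ → (v ∈ Λ δ ↔ m δ ≤ v.1 1))) ∧
      (∀ K : Set ℂ, IsCompact K → K ⊆ D.carrier →
          ∀ᶠ δ : ℝ in 𝓝[>] 0, ∀ v : HexVertex, (δ : ℂ) * hexCenter v ∈ K → v ∈ Λ δ) ∧
      Tendsto (fun δ : ℝ => (δ : ℂ) * hexMidpoint (b δ)) (𝓝[>] 0) (𝓝 (D.pt 1))) →
    ∀ (x : ℂ) (e : ℝ → Sym2 HexVertex) (r : ℝ) (mr : ℝ → ℤ),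
      (0 < r ∧
      D.carrier ∩ Metric.ball x r = {z : ℂ | x.im < z.im} ∩ Metric.ball x r ∧
      (∀ᶠ δ : ℝ in 𝓝[>] 0, e δ ∈ hexDomainBoundary (Λ δ) ∧ Nonempty (HexMidEdgeSAW (Λ δ) (e δ) (b δ)) ∧
          (∀ v : HexVertex, (δ : ℂ) * hexCenter v ∈ Metric.ball x r → (v ∈ Λ δ ↔ mr δ ≤ v.1 1))) ∧
      Tendsto (fun δ : ℝ => (δ : ℂ) * hexMidpoint (e δ)) (𝓝[>] 0) (𝓝 x)) → x ≠ D.pt 1 →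
    let Z : ℝ → Sym2 HexVertex → ℝ := fun δ z =>
      ‖hexParafermionicObservable (Λ δ) (e δ) hexCriticalFugacity 0 z‖
    (∀ (y : ℂ) (ρ' : ℝ), y.im = (D.pt 1).im → 0 < ρ' →
        Metric.closedBall y ρ' ⊆ Metric.ball (D.pt 1) ρ → x ∉ Metric.closedBall y (2 * ρ') →
      ∃ C : ℝ, 0 < C ∧ ∀ᶠ δ : ℝ in 𝓝[>] 0,
        C⁻¹ * Z δ (b δ) ≤ δ * ∑ᶠ e' ∈ {e' : Sym2 HexVertex | e' ∈ hexDomainBoundary (Λ δ) ∧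
            (δ : ℂ) * hexMidpoint e' ∈ Metric.ball y ρ'}, Z δ e' ∧
        δ * ∑ᶠ e' ∈ {e' : Sym2 HexVertex | e' ∈ hexDomainBoundary (Λ δ) ∧
            (δ : ℂ) * hexMidpoint e' ∈ Metric.ball y ρ'}, Z δ e' ≤ C * Z δ (b δ)) ∧
    (∀ A : ℝ, ∃ η : ℝ, 0 < η ∧ η < r / 2 ∧ ∀ᶠ δ : ℝ in 𝓝[>] 0,
        A * Z δ (b δ) ≤ δ * ∑ᶠ e' ∈ {e' : Sym2 HexVertex | e' ∈ hexDomainBoundary (Λ δ) ∧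
            (δ : ℂ) * hexMidpoint e' ∈ Metric.ball x (r / 2) ∧
            x.re + η < ((δ : ℂ) * hexMidpoint e').re}, Z δ e') := by
  intro hA hB D ρ Λ m b hAF x e r mr hPR hx
  refine ⟨fun y ρ' hy hρ' hball hxy => ?_, hB D ρ Λ m b hAF x e r mr hPR hx⟩
  have hpin : ∀ᶠ δ : ℝ in 𝓝[>] 0, ∀ v : HexVertex,
      (δ : ℂ) * hexCenter v ∈ Metric.ball (D.pt 1) ρ → (v ∈ Λ δ ↔ m δ ≤ v.1 1) :=
    hAF.2.2.1.mono fun δ hδ => hδ.2.2.2.2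
  have hb : ∀ᶠ δ : ℝ in 𝓝[>] 0, b δ ∈ hexDomainBoundary (Λ δ) :=
    hAF.2.2.1.mono fun δ hδ => hδ.2.1
  exact gateComparability_of_pointwise (Z := fun δ z =>
      ‖hexParafermionicObservable (Λ δ) (e δ) hexCriticalFugacity 0 z‖) hAF.1 hpin hb hAF.2.2.2.2
    (fun _ _ => norm_nonneg _) hy hρ' hball
    (hA D ρ Λ m b hAF x e r mr hPR hx y ρ' hy hρ' hball hxy)

end Summit.CriticalPhenomena.SAWScalingLimit.Theorems.PickHalfPlane.GateMass

end
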